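import Literature.AlgebraicGeometry.Frobenioids.ArchimedeanNonIsotropicIrreducibles
import HarnessLib

/-!
# Frobenioids II, Proposition 3.5 (ii) «⇒»: the arrows out of a non-isotropic object of `C` — factorisations

Mochizuki, *The geometry of Frobenioids II: poly-Frobenioids*, Kyushu J. Math. **62** (2008) 401–460,
§3, Proposition 3.5 (ii) and its proof, kurims text p. 35 ll. 12–27 [cite: MochizukiFrdII2008, Prop 3.5 (ii) p.34]:
"Now let `φ : C → C′` be an irreducible morphism. Then by [Mzk5], Definition 1.3, (iv), (v) …, it follows
that `φ` is either a pull-back morphism, an isometric pre-step, a co-angular pre-step …, or a prime-Frobenius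
morphism."

PROOF-ONLY companion, part 2 (abc-iut cell, layer L1, node `FrdII:Prop3.5(ii)`, sub-row P35-L05; seat
abc-iut-w4-d092): the explicit factorisations, in `C = C₀ ×_{D₀} D` over ANY `π : D → D₀`, that sort an
arrow `φ : X → Y` by the printed kinds —
* `powHom X d : X → X^{(d)}` (region `A_X^{⊗d}`) and `φ = powHom X (deg_Fr φ) ≫ φ′` with `φ′` linear
  (`fac_pow`); `powHom X d = extHom (hull) ≫ (𝟙, d, 1)` as soon as `B^d = S¹` (`fac_hull_pow`), so that
  Frobenius degrees of irreducible arrows out of a non-isotropic `X` are bounded (Lemma 3.2 (v));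
* `φ = k ≫ liftMor` through the pull-back of `Y` along `φ_D` (abc-iut-w4-d100's `QuotientLift.liftMor`), with
  `k` over `𝟙_{X_D}` (`fac_lift`): an irreducible `φ` with non-invertible `φ_D` is a pull-back morphism of `C₀`
  on its first component (`full_of_irreducible`);
* for linear `φ`: `φ = extHom X T₀ ≫ j` with `j` invertible when `φ_D` is (`fac_ext`);
* `pushHom X h : X → X_h := (X₀, Z, α_X ≫ π h)` along `h : X_D → Z` with `π Z` complex, and the comparison
  of a linear pull-back-type `φ` with `pushHom X φ_D` (`under_iso_push`), plus the lift of factorisations of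
  `φ_D` (`fac_push`).
No definitions of record; no statement of the paper is strengthened; nothing here bears on [IUTchIII] Cor. 3.12.
-/

namespace Literature.AlgebraicGeometry.Frobenioids

open CategoryTheory Set
open scoped Pointwise

noncomputable section

universe v u

namespace ArchFrd

variable {D : Type u} [Category.{v} D] (π : D ⥤ D0)

namespace NonIso

/-! ### The Frobenius-type arrow `X → X^{(d)}` onto `A_X^{⊗d}` -/

/-- `A_X^{⊗d}` as an angular region (chosen). [cite: MochizukiFrdII2008, Def 3.1 (iii) p.24] -/
def powRegion (A : AngularRegion ℂ) (d : ℕ+) : AngularRegion ℂ :=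
  (AngularRegion.exists_powRegion A d.natPred).choose

/-- The data of `A^{⊗d}`: angular part `B^d`, tip `λ^d`, point set `A^d`.
[cite: MochizukiFrdII2008, Def 3.1 (iii) p.24] -/
theorem powRegion_spec (A : AngularRegion ℂ) (d : ℕ+) :
    (powRegion A d).dir = A.dir ^ (d : ℕ) ∧ (powRegion A d).tip = A.tip ^ (d : ℕ) ∧
      (powRegion A d).carrier = A.carrier ^ (d : ℕ) := by
  obtain ⟨h1, h2, h3⟩ := (AngularRegion.exists_powRegion A d.natPred).choose_spec
  have e : d.natPred + 1 = (d : ℕ) := d.natPred_add_one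
  exact ⟨h1.trans (by rw [e]), h2.trans (by rw [e]), h3.trans (by rw [e])⟩

/-- `X^{(d)}`: base data of `X`, region `A_X^{⊗d}`. [cite: MochizukiFrdII2008, Ex 3.3 (i) p.27] -/
abbrev powObj (X : C π) (d : ℕ+) : C π :=
  ⟨⟨X.fst.base, powRegion X.fst.region d, fun h => by
      change (powRegion X.fst.region d).dir = univ
      rw [(powRegion_spec X.fst.region d).1, show X.fst.region.dir = univ from X.fst.isIsotropic_of_isReal h]
      exact Set.univ_pow d.ne_zero⟩, X.snd, X.iso⟩

/-- The Frobenius-type arrow `((𝟙, d, 1), 𝟙) : X → X^{(d)}`. [cite: MochizukiFrdII2008, Ex 3.3 (i) p.27] -/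
def powHom (X : C π) (d : ℕ+) : X ⟶ powObj π X d where
  fst :=
    { base := 𝟙 _, degFr := d, scalar := 1, scalar_mem := one_mem _,
      mapsTo := by
        rw [one_smul]
        change X.fst.region.carrier ^ (d : ℕ) ⊆ C0.pullRegion ⟨X.fst.base, powRegion X.fst.region d, _⟩ (𝟙 _)
        rw [C0.pullRegion_id, (powRegion_spec X.fst.region d).2.2] }
  snd := 𝟙 X.snd
  w := by
    change 𝟙 _ ≫ X.iso.hom = X.iso.hom ≫ π.map (𝟙 X.snd)
    rw [CategoryTheory.Functor.map_id, Category.id_comp, Category.comp_id]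

/-- `deg_Fr(powHom X d) = d`. [cite: MochizukiFrdII2008, Ex 3.3 (i) p.27] -/
@[simp] theorem degFr_powHom (X : C π) (d : ℕ+) : C0.degFr (powHom π X d).fst = d := rfl

/-- `powHom X d` is an isomorphism only if `d = 1`. [cite: MochizukiFrdII2008, Ex 3.3 (i) p.27] -/
theorem eq_one_of_isIso_powHom (X : C π) (d : ℕ+) [IsIso (powHom π X d)] : d = 1 :=
  degFr_eq_one_of_isIso π (powHom π X d)

/-- **Every arrow factors through the Frobenius-type arrow of its degree**: `φ = powHom X d ≫ φ′` with
`φ′ = ((Base φ, 1, c), φ_D)` linear. [cite: MochizukiFrdII2008, Prop 3.5 (ii) p.34] -/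
theorem fac_pow {X Y : C π} (φ : X ⟶ Y) :
    ∃ φ' : powObj π X (C0.degFr φ.fst) ⟶ Y, powHom π X (C0.degFr φ.fst) ≫ φ' = φ ∧
      C0.degFr φ'.fst = 1 ∧ C0.scalar φ'.fst = C0.scalar φ.fst ∧ φ'.snd = φ.snd := by
  let φ₀ : (powObj π X (C0.degFr φ.fst)).fst ⟶ Y.fst :=
    { base := φ.fst.base, degFr := 1, scalar := C0.scalar φ.fst, scalar_mem := φ.fst.scalar_mem,
      mapsTo := by
        rw [PNat.one_coe, pow_one]
        change C0.scalar φ.fst • (powRegion X.fst.region (C0.degFr φ.fst)).carrier ⊆ _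
        rw [(powRegion_spec X.fst.region _).2.2]
        exact φ.fst.mapsTo }
  refine ⟨⟨φ₀, φ.snd, by exact φ.w⟩, ?_, rfl, rfl, rfl⟩
  refine CFP.hom_ext (C0.hom_ext (Category.id_comp _) (mul_one _) ?_) (Category.id_comp _)
  · change D0.Hom.act (𝟙 X.fst.base) (C0.scalar φ.fst) * 1 ^ ((1 : ℕ+) : ℕ) = C0.scalar φ.fst
    unfold D0.Hom.act
    rw [D0.twists_id, D0.galAct_false, one_pow, mul_one]

/-- **`powHom` factors through the isotropic hull when `B^d = S¹`**: `powHom X d = extHom X (hull) ≫ (𝟙, d, 1)`.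
[cite: MochizukiFrdII2008, Prop 3.5 (ii) p.34] -/
theorem fac_hull_pow (X : C π) (d : ℕ+) (hd : X.fst.region.dir ^ (d : ℕ) = univ) :
    ∃ ψ : extObj π X (AngularRegion.isotropicOfTip X.fst.region.tip) (subset_univ _) ⟶ powObj π X d,
      extHom π X (AngularRegion.isotropicOfTip X.fst.region.tip) (subset_univ _) le_rfl ≫ ψ = powHom π X d ∧
        C0.degFr ψ.fst = d := by
  have hfull : (1 : ℂˣ) • (AngularRegion.isotropicOfTip (K := ℂ) X.fst.region.tip).carrier ^ (d : ℕ) =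
      (powRegion X.fst.region d).carrier := by
    rw [← d.natPred_add_one]
    refine C0.smul_carrier_pow_eq _ _ 1 d.natPred ?_ ?_
    · rw [unitPart_one, one_smul, d.natPred_add_one, (powRegion_spec X.fst.region d).1, hd]
      exact Set.univ_pow d.ne_zero
    · rw [map_one, one_mul, d.natPred_add_one, (powRegion_spec X.fst.region d).2.1]; rfl
  let ψ₀ : (extObj π X (AngularRegion.isotropicOfTip X.fst.region.tip) (subset_univ _)).fst ⟶ (powObj π X d).fst :=
    { base := 𝟙 X.fst.base, degFr := d, scalar := 1, scalar_mem := one_mem _,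
      mapsTo := by
        change (1 : ℂˣ) • (AngularRegion.isotropicOfTip (K := ℂ) X.fst.region.tip).carrier ^ (d : ℕ) ⊆
          C0.pullRegion ⟨X.fst.base, powRegion X.fst.region d, _⟩ (𝟙 _)
        rw [C0.pullRegion_id, hfull] }
  refine ⟨⟨ψ₀, 𝟙 X.snd, ?_⟩, ?_, rfl⟩
  · change 𝟙 _ ≫ X.iso.hom = X.iso.hom ≫ π.map (𝟙 X.snd)
    rw [CategoryTheory.Functor.map_id, Category.id_comp, Category.comp_id]
  · refine CFP.hom_ext (C0.hom_ext (Category.id_comp _) (one_mul _) ?_) (Category.id_comp _)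
    change D0.Hom.act (𝟙 X.fst.base) (1 : ℂˣ) * 1 ^ (d : ℕ) = 1
    rw [map_one, one_pow, mul_one]

/-- **Frobenius degrees of irreducible arrows out of `X` are bounded** when `X` is not naively isotropic:
with `N` as in `exists_pow_dir_eq_univ`, an irreducible `powHom X d` has `d ≤ N`.
[cite: MochizukiFrdII2008, Prop 3.5 (ii) p.34] -/
theorem natPred_lt_of_irreducible_powHom (X : C π) (hX : ¬ X.fst.region.IsIsotropic) {N : ℕ}
    (hN : ∀ n : ℕ, N ≤ n → X.fst.region.dir ^ (n + 1) = univ) (d : ℕ+)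
    (hirr : IsIrreducibleHom (powHom π X d)) : d.natPred < N := by
  by_contra hle
  have hd : X.fst.region.dir ^ (d : ℕ) = univ := by
    rw [← d.natPred_add_one]; exact hN _ (not_lt.mp hle)
  obtain ⟨ψ, hfac, hψ⟩ := fac_hull_pow π X d hd
  rcases hirr.2 _ _ hfac with hi | hi
  · haveI := hi
    have h1 : d = 1 := by rw [← hψ]; exact degFr_eq_one_of_isIso π ψ
    have h2 : d ≠ 1 := fun h => hirr.1 (by
      subst h
      haveI : IsIso (C0.Base (powHom π X 1).fst) := by change IsIso (𝟙 X.fst.base); infer_instance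
      haveI : IsIso (powHom π X 1).fst := by
        refine C0.isIso_of _ rfl ?_
        change (1 : ℂˣ) • X.fst.region.carrier = C0.pullRegion ⟨X.fst.base, powRegion X.fst.region 1, _⟩ (𝟙 _)
        rw [C0.pullRegion_id, (powRegion_spec X.fst.region 1).2.2, PNat.one_coe, pow_one, one_smul]
      haveI : IsIso (powHom π X 1).snd := by change IsIso (𝟙 X.snd); infer_instance
      exact CFP.isIso_of_isIso_fst_snd _)
    exact h2 h1
  · haveI := hi
    have := eq_of_isIso_extHom π X (AngularRegion.isotropicOfTip X.fst.region.tip) (subset_univ _) le_rfl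
    exact hX (by rw [this]; rfl)

/-! ### Factorisation through the pull-back of the target along `φ_D` -/

/-- `Base(φ₀) = α_X ≫ π(φ_D) ≫ α_Y⁻¹` for an arrow `φ = (φ₀, φ_D)` of `C`. [cite: MochizukiFrdI2008, Prop. 1.6] -/
theorem base_fst_eq {X Y : C π} (φ : X ⟶ Y) :
    C0.Base φ.fst = (QuotientLift.baseIso π X).hom ≫ QuotientLift.liftBase π Y φ.snd := by
  have w : C0.Base φ.fst ≫ (QuotientLift.baseIso π Y).hom = (QuotientLift.baseIso π X).hom ≫ π.map φ.snd :=
    φ.w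
  rw [← cancel_mono (QuotientLift.baseIso π Y).hom, w]
  simp only [QuotientLift.liftBase, Category.assoc, Iso.inv_hom_id, Category.comp_id]

/-- **`φ = k ≫ liftMor`**: every arrow factors through the pull-back of its target along its `D`-component,
the first factor lying over `𝟙_{X_D}` with the degree and scalar of `φ`.
[cite: MochizukiFrdII2008, Prop 3.5 (ii) p.34] -/
theorem fac_lift {X Y : C π} (φ : X ⟶ Y) :
    ∃ k : X ⟶ QuotientLift.liftObj π Y φ.snd, k ≫ QuotientLift.liftMor π Y φ.snd = φ ∧
      C0.Base k.fst = (QuotientLift.baseIso π X).hom ∧ C0.degFr k.fst = C0.degFr φ.fst ∧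
        C0.scalar k.fst = C0.scalar φ.fst ∧ k.snd = 𝟙 X.snd := by
  let k₀ : X.fst ⟶ QuotientLift.liftC0 π Y φ.snd :=
    { base := (QuotientLift.baseIso π X).hom, degFr := C0.degFr φ.fst, scalar := C0.scalar φ.fst,
      scalar_mem := φ.fst.scalar_mem,
      mapsTo := by
        change _ ⊆ D0.Hom.act (QuotientLift.baseIso π X).hom '' (QuotientLift.liftRegion π Y φ.snd).carrier
        rw [QuotientLift.liftRegion_carrier, ← C0.pullRegion_comp, ← base_fst_eq]
        exact φ.fst.mapsTo }
  refine ⟨⟨k₀, 𝟙 X.snd, ?_⟩, ?_, rfl, rfl, rfl, rfl⟩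
  · change (QuotientLift.baseIso π X).hom ≫ 𝟙 _ = (QuotientLift.baseIso π X).hom ≫ π.map (𝟙 X.snd)
    rw [CategoryTheory.Functor.map_id]
  · refine CFP.hom_ext (C0.hom_ext ?_ ?_ ?_) (Category.id_comp _)
    · change (QuotientLift.baseIso π X).hom ≫ QuotientLift.liftBase π Y φ.snd = C0.Base φ.fst
      rw [base_fst_eq]
    · change C0.degFr φ.fst * 1 = C0.degFr φ.fst
      rw [mul_one]
    · change D0.Hom.act (QuotientLift.baseIso π X).hom (1 : ℂˣ) * C0.scalar φ.fst ^ ((1 : ℕ+) : ℕ) =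
        C0.scalar φ.fst
      rw [map_one, one_mul, PNat.one_coe, pow_one]

/-- **An irreducible arrow whose `D`-component is not invertible is a pull-back morphism of `C₀` on its first
component** (it is linear and `c · A_X = A_Y|_{Base φ}`). [cite: MochizukiFrdII2008, Prop 3.5 (ii) p.34] -/
theorem full_of_irreducible {X Y : C π} (φ : X ⟶ Y) (hirr : IsIrreducibleHom φ) (hsnd : ¬ IsIso φ.snd) :
    C0.degFr φ.fst = 1 ∧ C0.scalar φ.fst • X.fst.region.carrier = C0.pullRegion Y.fst (C0.Base φ.fst) := by
  obtain ⟨k, hfac, hkb, hkd, hks, hksnd⟩ := fac_lift π φ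
  rcases hirr.2 _ _ hfac with hi | hi
  · haveI := hi
    exact absurd (CFP.isIso_snd (QuotientLift.liftMor π Y φ.snd)) hsnd
  · haveI := hi
    haveI : IsIso k.fst := CFP.isIso_fst k
    obtain ⟨-, hd, hfull⟩ := C0.of_isIso k.fst
    rw [hkd] at hd
    refine ⟨hd, ?_⟩
    rw [hks, hkb] at hfull
    change C0.scalar φ.fst • X.fst.region.carrier =
      D0.Hom.act (QuotientLift.baseIso π X).hom '' (QuotientLift.liftRegion π Y φ.snd).carrier at hfull
    rw [QuotientLift.liftRegion_carrier, ← C0.pullRegion_comp, ← base_fst_eq] at hfull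
    exact hfull

/-! ### The pre-step factorisation of a linear arrow -/

/-- **`φ = extHom X T₀ ≫ j` for a linear arrow `φ`**, where `T₀ = c⁻¹ · A_Y|_{Base φ}`; `j` is an isomorphism
as soon as `φ_D` is. [cite: MochizukiFrdII2008, Prop 3.5 (ii) p.34] -/
theorem fac_ext {X Y : C π} (φ : X ⟶ Y) (hd : C0.degFr φ.fst = 1) :
    ∃ (T₀ : AngularRegion ℂ) (hT : X.fst.region.dir ⊆ T₀.dir) (ht : X.fst.region.tip ≤ T₀.tip)
      (j : extObj π X T₀ hT ⟶ Y), extHom π X T₀ hT ht ≫ j = φ ∧ (IsIso φ.snd → IsIso j) := by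
  obtain ⟨S', hS'c, hS't, -, -⟩ := exists_pulledRegion Y.fst (C0.Base φ.fst)
  obtain ⟨T₀, hT₀d, hT₀t, hT₀c⟩ := AngularRegion.exists_smulRegion S' (C0.scalar φ.fst)⁻¹
  obtain ⟨hdir, htip⟩ := C0.hom_conditions φ.fst hS'c
  rw [hd, PNat.one_coe, pow_one] at hdir htip
  have hT : X.fst.region.dir ⊆ T₀.dir := by
    rw [hT₀d, unitPart_inv]
    exact Set.subset_smul_set_iff.mpr hdir
  have ht : X.fst.region.tip ≤ T₀.tip := by
    have hc : 0 < ‖(C0.scalar φ.fst : ℂ)‖ := norm_pos_iff.mpr (C0.scalar φ.fst).ne_zero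
    rw [← Subtype.coe_le_coe, hT₀t, Positive.val_mul, coe_absHom, Units.val_inv_eq_inv_val, norm_inv,
      ← C0.tip_eq, le_inv_mul_iff₀ hc]
    exact htip
  have hcT : C0.scalar φ.fst • T₀.carrier = C0.pullRegion Y.fst (C0.Base φ.fst) := by
    rw [hT₀c, smul_smul, mul_inv_cancel, one_smul, hS'c]
  let j₀ : (extObj π X T₀ hT).fst ⟶ Y.fst :=
    { base := φ.fst.base, degFr := 1, scalar := C0.scalar φ.fst, scalar_mem := φ.fst.scalar_mem,
      mapsTo := by rw [PNat.one_coe, pow_one]; exact hcT.le }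
  let j : extObj π X T₀ hT ⟶ Y := ⟨j₀, φ.snd, by exact φ.w⟩
  refine ⟨T₀, hT, ht, j, ?_, fun hs => ?_⟩
  · refine CFP.hom_ext (C0.hom_ext (Category.id_comp _) ?_ ?_) (Category.id_comp _)
    · change (1 : ℕ+) * 1 = C0.degFr φ.fst
      rw [hd, mul_one]
    · change D0.Hom.act (𝟙 X.fst.base) (C0.scalar φ.fst) * 1 ^ ((1 : ℕ+) : ℕ) = C0.scalar φ.fst
      unfold D0.Hom.act
      rw [D0.twists_id, D0.galAct_false, one_pow, mul_one]
  · haveI := hs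
    haveI : IsIso (QuotientLift.liftBase π Y φ.snd) := by unfold QuotientLift.liftBase; infer_instance
    haveI : IsIso (C0.Base φ.fst) := by rw [base_fst_eq]; infer_instance
    haveI : IsIso (C0.Base j.fst) := by change IsIso (C0.Base φ.fst); infer_instance
    haveI : IsIso j.fst := C0.isIso_of j.fst rfl hcT
    haveI : IsIso j.snd := hs
    exact CFP.isIso_of_isIso_fst_snd _

/-! ### Push-forward along an arrow of `D` into a complex object -/

/-- `X_h := (X₀, Z, α_X ≫ π h)` for `h : X_D → Z` with `π Z = Spec ℂ` (then `π h` is invertible).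
[cite: MochizukiFrdII2008, Prop 3.5 (ii) p.34] -/
abbrev pushObj (X : C π) {Z : D} (h : X.snd ⟶ Z) (hZ : (π.obj Z).IsComplex) : C π :=
  ⟨X.fst, Z, X.iso ≪≫ @asIso _ _ _ _ (π.map h) (QuotientLift.isIso_of_target_eq_complex (π.map h) hZ)⟩

/-- The arrow `(𝟙, h) : X → X_h`. [cite: MochizukiFrdII2008, Prop 3.5 (ii) p.34] -/
def pushHom (X : C π) {Z : D} (h : X.snd ⟶ Z) (hZ : (π.obj Z).IsComplex) : X ⟶ pushObj π X h hZ where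
  fst := 𝟙 X.fst
  snd := h
  w := by
    change 𝟙 _ ≫ X.iso.hom ≫ π.map h = X.iso.hom ≫ π.map h
    exact Category.id_comp _

/-- `pushHom X h` is an isomorphism iff `h` is. [cite: MochizukiFrdII2008, Prop 3.5 (ii) p.34] -/
theorem isIso_pushHom_iff (X : C π) {Z : D} (h : X.snd ⟶ Z) (hZ : (π.obj Z).IsComplex) :
    IsIso (pushHom π X h hZ) ↔ IsIso h := by
  constructor
  · intro hi; exact CFP.isIso_snd (pushHom π X h hZ)
  · intro hi
    haveI : IsIso (pushHom π X h hZ).fst := by change IsIso (𝟙 X.fst); infer_instance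
    haveI : IsIso (pushHom π X h hZ).snd := hi
    exact CFP.isIso_of_isIso_fst_snd _

/-- Isomorphic arrows of `D` out of `X_D` (into complex objects) have isomorphic push-forwards under `X`.
[cite: MochizukiFrdII2008, Prop 3.5 (ii) p.34] -/
theorem push_under_iso (X : C π) {Z Z' : D} (h : X.snd ⟶ Z) (h' : X.snd ⟶ Z') (hZ : (π.obj Z).IsComplex)
    (hZ' : (π.obj Z').IsComplex) (ε : Z ≅ Z') (hε : h ≫ ε.hom = h') :
    Nonempty (Under.mk (pushHom π X h hZ) ≅ Under.mk (pushHom π X h' hZ')) := by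
  refine ⟨Under.isoMk (CFP.isoMk (Iso.refl X.fst) ε ?_) ?_⟩
  · change 𝟙 _ ≫ X.iso.hom ≫ π.map h' = (X.iso.hom ≫ π.map h) ≫ π.map ε.hom
    rw [Category.id_comp, Category.assoc, ← π.map_comp, hε]
  · exact CFP.hom_ext (Category.comp_id _) hε

/-- **A linear arrow `φ` with `c · A_X = A_Y|_{Base φ}` and complex target is isomorphic, under `X`, to the
push-forward of `X` along `φ_D`.** [cite: MochizukiFrdII2008, Prop 3.5 (ii) p.34] -/
theorem under_iso_push {X Y : C π} (φ : X ⟶ Y) (hd : C0.degFr φ.fst = 1)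
    (hfull : C0.scalar φ.fst • X.fst.region.carrier = C0.pullRegion Y.fst (C0.Base φ.fst))
    (hY : (π.obj Y.snd).IsComplex) :
    Nonempty (Under.mk (pushHom π X φ.snd hY) ≅ Under.mk φ) := by
  have hYb : Y.fst.base = D0.complex := (D0.eq_of_isIso Y.iso.hom).trans hY
  haveI : IsIso (C0.Base φ.fst) := QuotientLift.isIso_of_target_eq_complex _ hYb
  haveI : IsIso φ.fst := C0.isIso_of φ.fst hd hfull
  let e : pushObj π X φ.snd hY ≅ Y :=
    CFP.isoMk (asIso φ.fst) (Iso.refl Y.snd) (by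
      change C0.Base φ.fst ≫ Y.iso.hom = (X.iso.hom ≫ π.map φ.snd) ≫ π.map (𝟙 Y.snd)
      rw [CategoryTheory.Functor.map_id, Category.comp_id]
      exact φ.w)
  exact ⟨Under.isoMk e (CFP.hom_ext (Category.id_comp _) (Category.comp_id _))⟩

/-- **Factorisations of `φ_D` through complex objects lift to factorisations of `φ` through push-forwards.**
[cite: MochizukiFrdII2008, Prop 3.5 (ii) p.34] -/
theorem fac_push {X Y : C π} (φ : X ⟶ Y) {Z : D} (g : X.snd ⟶ Z) (h : Z ⟶ Y.snd) (hZ : (π.obj Z).IsComplex)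
    (hgh : g ≫ h = φ.snd) : ∃ ψ : pushObj π X g hZ ⟶ Y, pushHom π X g hZ ≫ ψ = φ ∧ ψ.snd = h := by
  refine ⟨⟨φ.fst, h, ?_⟩, CFP.hom_ext (Category.id_comp _) hgh, rfl⟩
  change C0.Base φ.fst ≫ Y.iso.hom = (X.iso.hom ≫ π.map g) ≫ π.map h
  rw [Category.assoc, ← π.map_comp, hgh]
  exact φ.w

end NonIso

end ArchFrd

end

end Literature.AlgebraicGeometry.Frobenioids
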